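import Summits.ValiantsHypothesis.ValiantsHypothesis.Theorems.VPBoundarySquareFewConstants
import HarnessLib

/-!
# VPBoundarySquare — the INTEGER SKELETON of a border family is free (decomp-valiant lens 3,
NODE v9, theorem T3)

`CHClosureDefinable` (U_CH, item 24721) asks, for every `\overline{VP}` p-family `f`, for
`w` , integer polynomials `Q_n ∈ ℤ[x_1..x_{v n}, y_1..y_{w n}]` and constants `κ_n ∈ ℂ^{w n}` with
`f_n = Q_n(x, κ_n)` AND `Q ∈ VCH⁰` (exponential format + `CH/poly`-definable coefficient function; the
format forces `w` p-bounded). This file proves that the SKELETON part — everything except `Q ∈ VCH⁰` —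
holds UNCONDITIONALLY with `w` p-bounded:

* `exists_intSkeleton` : if all coefficients of `g ∈ ℂ[x_v]` lie in `ℚ(κ_1, …, κ_m)` then
  `g = Q(x, κ')` for an integer polynomial `Q` and `m + 1` constants `κ'` (the given ones and one inverse
  `1 / (L · Z(κ))` clearing a common denominator `Z` and a common integer denominator `L`);
* `isVPBarFamily_intSkeleton` : every `\overline{VP}^ℂ` p-family is `Q_n(x, κ_n)` with `Q_n` INTEGER
  polynomials and `#κ_n` p-BOUNDED — by the few-constants theorem `isVPBarFamily_fewConstants` (T2).

So U_CH ⟺ «the free integer skeleton can be CHOSEN in `VCH⁰`»: what is open is exactly the exponential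
FORMAT (degree/height `2^{poly}`; its degree shadow on `f` is unconditional, `VPBoundarySquareDegree*`)
and the `CH/poly`-DEFINABILITY of `Q_n` — critic ruling R4's «compression» in precise form. Honest
scope: no statement of record changes; nothing here proves U_CH or bears on `VP ≠ VNP`; the skeleton
produced here has NO degree or height control. 0 sorry.
Sources: Bürgisser 2026 Def. 4.1–4.2 [corpus paper-arxiv-2606.25121 p0011]; BCS 1997 (5.9) (few
constants / transcendence degree) [corpus book chunk p0172].
-/

noncomputable section

set_option linter.dupNamespace false

open MvPolynomial
open Literature.Computability.AlgebraicComplexity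

namespace Summit.ValiantsHypothesis.ValiantsHypothesis.Theorems.VPBoundarySquareIntSkeleton

open Summit.ValiantsHypothesis.ValiantsHypothesis.Theses.VPBoundarySquare
open Summit.ValiantsHypothesis.ValiantsHypothesis.Theorems.VPBoundarySquareTrdeg
open Summit.ValiantsHypothesis.ValiantsHypothesis.Theorems.VPBoundarySquareFewConstants

/-! ### Clearing denominators -/

/-- Finitely many rationals have a common denominator. [folklore] -/
theorem exists_common_den {α : Type} (s : Finset α) (q : α → ℚ) :
    ∃ L : ℕ, 0 < L ∧ ∀ a ∈ s, ∃ z : ℤ, (z : ℚ) = q a * L := by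
  classical
  refine ⟨∏ a ∈ s, (q a).den, Finset.prod_pos fun a _ => (q a).den_pos, fun a ha => ?_⟩
  refine ⟨(q a).num * ∏ b ∈ s.erase a, ((q b).den : ℤ), ?_⟩
  rw [← Finset.mul_prod_erase s (fun b => (q b).den) ha]
  push_cast
  rw [← mul_assoc, Rat.mul_den_eq_num]

/-- Finitely many rational polynomials become integer polynomials after multiplication by a common
positive integer. [folklore] -/
theorem exists_int_lift {ι : Type} {m : ℕ} (s : Finset ι) (P : ι → MvPolynomial (Fin m) ℚ) :
    ∃ L : ℕ, 0 < L ∧ ∀ i ∈ s, ∃ P' : MvPolynomial (Fin m) ℤ,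
      MvPolynomial.map (Int.castRingHom ℚ) P' = (L : ℚ) • P i := by
  classical
  obtain ⟨L, hL, hz⟩ := exists_common_den (s.sigma fun i => (P i).support)
    (fun x : (Σ _ : ι, (Fin m →₀ ℕ)) => coeff x.2 (P x.1))
  refine ⟨L, hL, fun i hi => ?_⟩
  have h : ∀ e, ∃ z : ℤ, (z : ℚ) = coeff e (P i) * L := by
    intro e
    by_cases he : e ∈ (P i).support
    · exact hz ⟨i, e⟩ (Finset.mem_sigma.mpr ⟨hi, he⟩)
    · exact ⟨0, by rw [notMem_support_iff.mp he]; simp⟩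
  choose z hz' using h
  refine ⟨∑ e ∈ (P i).support, monomial e (z e), ?_⟩
  ext e
  rw [coeff_map, coeff_sum, coeff_smul, smul_eq_mul]
  by_cases he : e ∈ (P i).support
  · rw [Finset.sum_eq_single e (fun e' _ hne => by rw [coeff_monomial, if_neg hne]) (fun h => absurd he h),
      coeff_monomial, if_pos rfl, eq_intCast, hz', mul_comm]
  · rw [Finset.sum_eq_zero fun e' he' => by
        rw [coeff_monomial]; exact if_neg fun h : e' = e => he (h ▸ he'), map_zero, notMem_support_iff.mp he,
      mul_zero]

/-! ### Evaluating one skeleton term -/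

/-- `Q ↦ Q(x, κ')` applied to the term `x^d · R(y)` gives the monomial `R(κ') · x^d`. [folklore] -/
theorem aeval_skeletonTerm {v w : ℕ} (κ' : Fin w → ℂ) (d : Fin v →₀ ℕ) (R : MvPolynomial (Fin w) ℤ) :
    aeval (Fin.append X fun j => C (κ' j)) (MvPolynomial.map (Int.castRingHom ℂ)
      (rename (Fin.castAdd w) (monomial d (1 : ℤ)) * rename (Fin.natAdd v) R)) =
      monomial d (eval₂Hom (Int.castRingHom ℂ) κ' R) := by
  have h1 : ((Fin.append X fun j => C (κ' j)) : Fin (v + w) → MvPolynomial (Fin v) ℂ) ∘ Fin.castAdd w =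
      X := funext fun i => Fin.append_left _ _ i
  have h2 : ((Fin.append X fun j => C (κ' j)) : Fin (v + w) → MvPolynomial (Fin v) ℂ) ∘ Fin.natAdd v =
      algebraMap ℂ (MvPolynomial (Fin v) ℂ) ∘ κ' := funext fun j => Fin.append_right _ _ j
  rw [map_mul, map_rename, map_rename, map_mul, aeval_rename, aeval_rename, h1, h2, map_monomial, map_one,
    aeval_X_left_apply, aeval_algebraMap_apply, algebraMap_eq, mul_comm, C_mul_monomial, mul_one]
  congr 1
  rw [aeval_def, eval₂_map, coe_eval₂Hom, RingHom.ext_int ((algebraMap ℂ ℂ).comp (Int.castRingHom ℂ))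
    (Int.castRingHom ℂ)]

/-! ### The integer skeleton -/

/-- **Integer skeleton with one extra constant.** If every coefficient of `g ∈ ℂ[x_1..x_v]` lies in
`ℚ(κ_1, …, κ_m)`, then `g = Q(x, κ')` for some `Q ∈ ℤ[x_1..x_v, y_1..y_{m+1}]` and `κ' ∈ ℂ^{m+1}`.
[cite: Burgisser2026HNC, Def. 4.2 (p. 11)] -/
theorem exists_intSkeleton {v m : ℕ} (g : MvPolynomial (Fin v) ℂ) (κ : Fin m → ℂ)
    (hg : ∀ d, coeff d g ∈ IntermediateField.adjoin ℚ (Set.range κ)) :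
    ∃ (Q : MvPolynomial (Fin (v + (m + 1))) ℤ) (κ' : Fin (m + 1) → ℂ),
      g = aeval (Fin.append X fun j => C (κ' j)) (MvPolynomial.map (Int.castRingHom ℂ) Q) := by
  classical
  -- coefficients as fractions of polynomial values
  have h1 : ∀ d, ∃ r s : MvPolynomial (Fin m) ℚ, coeff d g = aeval κ r / aeval κ s :=
    fun d => (IntermediateField.mem_adjoin_range_iff ℚ κ _).mp (hg d)
  choose r s hrs using h1
  have hs : ∀ d ∈ g.support, aeval κ (s d) ≠ 0 := by
    intro d hd h0
    exact mem_support_iff.mp hd (by rw [hrs d, h0, div_zero])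
  -- common denominator
  set Z : MvPolynomial (Fin m) ℚ := ∏ d ∈ g.support, s d with hZdef
  have hZ : aeval κ Z ≠ 0 := by
    rw [hZdef, map_prod]
    exact Finset.prod_ne_zero_iff.mpr hs
  let P : (Fin v →₀ ℕ) → MvPolynomial (Fin m) ℚ := fun d => r d * ∏ d' ∈ g.support.erase d, s d'
  have hP : ∀ d ∈ g.support, coeff d g = aeval κ (P d) / aeval κ Z := by
    intro d hd
    have hE : aeval κ (∏ d' ∈ g.support.erase d, s d') ≠ 0 := by
      rw [map_prod]
      exact Finset.prod_ne_zero_iff.mpr fun d' hd' => hs d' (Finset.mem_of_mem_erase hd')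
    rw [hrs d, hZdef, ← Finset.mul_prod_erase g.support s hd, map_mul, map_mul, mul_div_mul_right _ _ hE]
  -- integer lifts of the numerators
  obtain ⟨L, hL, hlift⟩ := exists_int_lift g.support P
  choose! P' hP' using hlift
  have hLC : (L : ℂ) ≠ 0 := Nat.cast_ne_zero.mpr hL.ne'
  -- the constants: κ and the inverse of the common denominator
  let extra : ℂ := ((L : ℂ) * aeval κ Z)⁻¹
  let κ' : Fin (m + 1) → ℂ := Fin.snoc κ extra
  -- the skeleton
  let R : (Fin v →₀ ℕ) → MvPolynomial (Fin (m + 1)) ℤ := fun d =>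
    rename Fin.castSucc (P' d) * X (Fin.last m)
  refine ⟨∑ d ∈ g.support, rename (Fin.castAdd (m + 1)) (monomial d (1 : ℤ)) * rename (Fin.natAdd v) (R d),
    κ', ?_⟩
  have hR : ∀ d ∈ g.support, eval₂Hom (Int.castRingHom ℂ) κ' (R d) = coeff d g := by
    intro d hd
    have hκ : (κ' ∘ Fin.castSucc : Fin m → ℂ) = κ := funext fun j => Fin.snoc_castSucc (α := fun _ => ℂ) _ _ j
    simp only [R, map_mul, coe_eval₂Hom, eval₂_rename, eval₂_X, hκ]
    have hlast : κ' (Fin.last m) = extra := Fin.snoc_last (α := fun _ => ℂ) _ _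
    rw [hlast, ← coe_eval₂Hom, ← aeval_map_intCast, hP' d hd, map_smul, hP d hd]
    rw [Nat.cast_smul_eq_nsmul, nsmul_eq_mul]
    simp only [extra]
    field_simp
  rw [map_sum, map_sum]
  conv_lhs => rw [g.as_sum]
  refine Finset.sum_congr rfl fun d hd => ?_
  rw [aeval_skeletonTerm, hR d hd]

/-- **Every `\overline{VP}^ℂ` p-family has a p-bounded INTEGER SKELETON**: `f_n = Q_n(x, κ_n)` with
`Q_n ∈ ℤ[x, y_1..y_{w n}]`, `κ_n ∈ ℂ^{w n}`, `w` p-bounded — unconditionally (T2 + clearing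
denominators). U_CH (`CHClosureDefinable`, item 24721) is exactly the assertion that such a skeleton can
be chosen with `Q ∈ VCH⁰`. [cite: Burgisser2026HNC, Def. 4.2 (p. 11)] [cite: BurgisserEtAl2011, §9.3 (closure of VP)] -/
theorem isVPBarFamily_intSkeleton {v : ℕ → ℕ} {f : ∀ n, MvPolynomial (Fin (v n)) ℂ}
    (hpf : IsPFamily f) (hf : IsVPBarFamily f) :
    ∃ (w : ℕ → ℕ) (Q : ∀ n, MvPolynomial (Fin (v n + w n)) ℤ) (κ : ∀ n, Fin (w n) → ℂ),
      IsPBounded w ∧ ∀ n, f n = aeval (Fin.append X fun j => C (κ n j)) (MvPolynomial.map (Int.castRingHom ℂ) (Q n)) := by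
  obtain ⟨m, hm, hκ⟩ := isVPBarFamily_fewConstants hpf hf
  choose κ hκ using hκ
  have hsk := fun n => exists_intSkeleton (f n) (κ n) (hκ n)
  choose Q κ' hQ using hsk
  exact ⟨fun n => m n + 1, Q, κ', IsPBounded.add_holds hm (IsPBounded.const 1), hQ⟩

/-- **U_CH restated over the free skeleton**: `CHClosureDefinable` holds iff every `\overline{VP}` p-family
admits an integer skeleton `Q ∈ VCH⁰` — recorded to make explicit that, after
`isVPBarFamily_intSkeleton`, the open content of item 24721 is the CHOICE of the skeleton inside `VCH⁰`
(exponential format + `CH/poly`-definability), nothing else. [cite: Burgisser2026HNC, Def. 4.2 (p. 11)] -/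
theorem chClosureDefinable_iff :
    CHClosureDefinable ↔ ∀ (v : ℕ → ℕ) (f : ∀ n, MvPolynomial (Fin (v n)) ℂ), IsPFamily f → IsVPBarFamily f →
      ∃ (w : ℕ → ℕ) (Q : ∀ n, MvPolynomial (Fin (v n + w n)) ℤ) (κ : ∀ n, Fin (w n) → ℂ),
        IsVCH0Family Q ∧ ∀ n, f n = aeval (Fin.append X fun j => C (κ n j))
          (MvPolynomial.map (Int.castRingHom ℂ) (Q n)) :=
  Iff.rfl

end Summit.ValiantsHypothesis.ValiantsHypothesis.Theorems.VPBoundarySquareIntSkeleton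

end
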